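import Summits.AnomalousDissipation.AnomalousDissipation.Theses.TwoAndHalfD
import Summits.AnomalousDissipation.AnomalousDissipation.Theorems.TwoAndHalfDTwohalfdThesisClassicalTransfer
import Summits.AnomalousDissipation.AnomalousDissipation.Theorems.TwoAndHalfDTwohalfdThesisSiblingReduction
import Summits.AnomalousDissipation.AnomalousDissipation.Theorems.TwohalfdThesis.Negative.TwohalfdThesisFalseOfSubLogStrain
import Literature.Analysis.FluidPDE.LongTimeAveragePeriodic

/-!
# Strategist census — crux `TwoAndHalfD.ScalarAnomalySteadySourceFormal` (stmt-AnomalousDissipation-0448)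

Typed companions of `STRATEGY-CENSUS.md` (crux-strategist seat `cstrat-stmt-AnomalousDissipation-0448-s1`,
2026-08-17).  NOTHING here is a line or a stub of the crux: these are the signatures the census refers to,
checked to elaborate against the current tree, together with the by-name implications that locate each of
them relative to the crux `#2 := ScalarAnomalySteadySourceFormal` (all bookkeeping over LANDED theorems;
no new analysis, no `sorry`).

* TRANSFER.  `SourcedAnomalyTwoParam ν κ` — the crux with the Prandtl coupling released (viscosity `ν_j`
  for the planar Leray–Hopf flow, diffusivity `κ_j` for the sourced scalar); `crux_iff_diagonal` — the crux IS
  its diagonal `κ = ν → 0`; `FixedViscositySibling` — the Batchelor-regime sibling `ν` FIXED, `κ_j → 0`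
  (the deterministic shape of Bedrossian–Blumenthal–Punshon-Smith, arXiv:1911.11014), whose bounded-variance
  clause is exactly what the solved stochastic sibling does NOT deliver (variance `≍ |log κ|`, loc. cit.
  Remark 1.6, p. 8).
* STRENGTHEN.  `PeriodicClassicalWitness` (`S⁺_per`: time-periodic classical planar states with `j`-uniformly
  bounded periods, pointwise budgets and a period-average dissipation floor) and
  `periodicClassicalWitness_imp : S⁺_per → #2` (period average = `limsup` long-time mean,
  `longTimeAvgSup_eq_of_periodic`; the landed classical junction p90898; `X → #2`, p133429).
* DECOMPOSITION.  (D1) `LogStrainFamily` — the NECESSARY first piece of every witness (a bounded-energy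
  steadily forced planar Leray–Hopf family that is not sub-log-strain) with `logStrainFamily_of_crux : #2 →
  LogStrainFamily` (contrapositive of the landed negative chain); (D2) `IsProfileMixerFamily` /
  `KinematicTemplate` / `ShadowedTemplate` / `ShadowGlue` — the template-and-shadow split of the live kernel
  S1' (`stub_profileMixerRealizable`), typed as signatures.
* NEGATION.  `not_crux_of_subLogStrain : SubLogStrain → ¬ #2` — the counterexample to the crux IS the planar
  sub-log strain law `SubLogStrain` (the `@[conjecture]` node of the negative crux stmt-0211, its registered
  residual S6), by the landed certificates.
-/

noncomputable section

set_option linter.dupNamespace false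

namespace Summit.AnomalousDissipation.AnomalousDissipation.Cruxes.ScalarAnomalySteadySourceFormal.StrategistCensus

open MeasureTheory Set Filter Topology
open scoped ENNReal NNReal InnerProductSpace
open Literature.Analysis.FunctionSpaces Literature.Analysis.FluidPDE
open Summit.AnomalousDissipation.AnomalousDissipation.Theses.TwoAndHalfD
open Summit.AnomalousDissipation.AnomalousDissipation.Theorems.TwohalfdThesis

/-- Local notation: the flat unit two-torus. -/
local notation "𝕋²" => UnitAddTorus (Fin 2)
/-- Local notation: planar velocity values. -/
local notation "E²" => EuclideanSpace ℝ (Fin 2)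

/-! ## Transfer: the Prandtl-decoupled family and the fixed-viscosity (Batchelor-regime) sibling -/

/-- **The crux with the Prandtl coupling released.**  For two index sequences `ν` (viscosity of the planar
Leray–Hopf flow) and `κ` (diffusivity of the sourced scalar): one smooth solenoidal mean-zero steady force `g`,
one smooth mean-zero steady source `h`, planar global Leray–Hopf solutions `v_j` of NS_{ν_j} forced by `g` (any
`L²` data), weak solutions `θ_j` of `∂ₜθ + v_j·∇θ = κ_jΔθ + h` from `L²` data, with `ν`-uniformly bounded
`limsup`-mean planar energy and scalar variance and a positive floor for the `limsup`-mean scalar dissipation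
`κ_j‖∇θ_j‖²`.  Verbatim the body of `ScalarAnomalySteadySourceFormal` with `κ j` in the three scalar slots. -/
def SourcedAnomalyTwoParam (ν κ : ℕ → ℝ) : Prop :=
  ∃ (g : 𝕋² → E²) (h : 𝕋² → ℝ),
    Torus.IsSmooth g ∧ Torus.IsDivFree g ∧ Torus.HasZeroMean g ∧ Torus.IsSmooth h ∧ Torus.HasZeroMean h ∧
    ∃ (v₀ : ℕ → 𝕋² → E²) (v : ℕ → ℝ → 𝕋² → E²) (θ₀ : ℕ → 𝕋² → ℝ) (θ : ℕ → ℝ → 𝕋² → ℝ),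
      (∀ j, 0 < ν j) ∧ (∀ j, 0 < κ j) ∧
      (∀ j, Torus.IsGlobalLerayHopf (ν j) (fun _ => g) (v₀ j) (v j)) ∧
      (∀ j, MemLp (θ₀ j) 2 volume) ∧
      (∀ j, Torus.IsWeakScalarTransportForced (κ j) (v j) (fun _ => h) (θ₀ j) (θ j)) ∧
      (∃ E : ℝ, ∀ j, meanEnergy (v j) ≤ E) ∧
      (∃ E : ℝ, ∀ j, longTimeAvgSup (fun t => Torus.scalarL2Sq (θ j t)) ≤ E) ∧
      ∃ ε : ℝ, 0 < ε ∧ ∀ j, ε ≤ longTimeAvgSup (fun t => κ j * (Torus.eScalarGradNormSq (θ j t)).toReal)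

/-- **The crux is the DIAGONAL `κ = ν → 0` of the two-parameter family** (pure bookkeeping: the existential
quantifiers commute). [folklore] -/
theorem crux_iff_diagonal :
    ScalarAnomalySteadySourceFormal ↔
      ∃ ν : ℕ → ℝ, Tendsto ν atTop (𝓝 0) ∧ SourcedAnomalyTwoParam ν ν := by
  constructor
  · rintro ⟨g, h, hgs, hgd, hgm, hhs, hhm, ν, v₀, v, θ₀, θ, hν, hν0, hLH, hθ₀, hθ, hE, hV, hε⟩
    exact ⟨ν, hν0, g, h, hgs, hgd, hgm, hhs, hhm, v₀, v, θ₀, θ, hν, hν, hLH, hθ₀, hθ, hE, hV, hε⟩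
  · rintro ⟨ν, hν0, g, h, hgs, hgd, hgm, hhs, hhm, v₀, v, θ₀, θ, hν, -, hLH, hθ₀, hθ, hE, hV, hε⟩
    exact ⟨g, h, hgs, hgd, hgm, hhs, hhm, ν, v₀, v, θ₀, θ, hν, hν0, hLH, hθ₀, hθ, hE, hV, hε⟩

/-- **The fixed-viscosity (Batchelor-regime) sibling.**  Viscosity FIXED at some `ν₀ > 0`, diffusivity
`κ_j → 0`: the deterministic, steady-force shape of the setting of Bedrossian–Blumenthal–Punshon-Smith
(arXiv:1911.11014: stochastic forcing, fixed Reynolds number, `κ → 0`).  The census records that the solved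
stochastic sibling delivers the FLUX clause (cumulative Batchelor spectrum, Thm 1.3) but NOT the bounded-variance
clause — the stationary variance diverges like `|log κ|` (Remark 1.6, p. 8), the Batchelor logarithm of any
flow mixing at a `κ`-independent exponential rate — so the transfer to the crux breaks at clause (v) before it
breaks at `ν`-uniformity: along the diagonal `κ = ν_j` the flow must speed its own mixing up like `log(1/ν_j)`
(the landed strain gate).  Not asserted; a signature only. -/
def FixedViscositySibling : Prop :=
  ∃ ν₀ : ℝ, 0 < ν₀ ∧ ∃ κ : ℕ → ℝ, Tendsto κ atTop (𝓝 0) ∧ SourcedAnomalyTwoParam (fun _ => ν₀) κ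

/-! ## Strengthen: `S⁺_per` — time-periodic classical witnesses with uniformly bounded periods -/

/-- **`S⁺_per` (STRENGTHEN candidate).**  One steady `(g, h)` as in the crux, `ν_j → 0`, and for every `j` a
CLASSICAL planar Navier–Stokes solution `(v_j, p_j)` forced by `g` on `[0, ∞)` and a CLASSICAL sourced scalar
`θ_j` (`∂ₜθ + v_j·∇θ = ν_jΔθ + h`) which are TIME-PERIODIC with a common period bound, `0 < T_j ≤ T⋆`, with
POINTWISE budgets `∫‖v_j(t)‖² ≤ E`, `‖θ_j(t)‖² ≤ B` (`t ≥ 0`) and a PERIOD-AVERAGE dissipation floor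
`T_j⁻¹ ∫₀^{T_j} ν_j‖∇θ_j(t)‖² dt ≥ ε > 0`.  Every `limsup` disappears (period averages), each level is a
compact (Floquet / period-map) problem, and `S⁺_per → #2` is kernel-checked below.  The census records why the
rigidity buys nothing for the `ν`-uniformity: for a `j`-INDEPENDENT periodic Lipschitz stirrer even the optimal
dissipation rate is `c/|log κ|` (Elgindi–Liss–Mattingly, arXiv:2304.05374 Thm 1, p. 3), so `j`-uniform scalar
budgets force the orbits to speed up without bound (`decay_clause_not_uniformlyLipschitz`, p118298), while at
bounded energy a sped-up orbit must move to scales `≲ 1/log(1/ν_j)` and then mixes the fixed profile `h` only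
at the eddy-diffusive rate `~ 1/log(1/ν_j)` — realisability of such orbits by ONE steady force is the crux again,
with an extra constraint (triaged as costume on the sibling item, TRIAGE-r1-1 and TRIAGE-r1-2 of stmt-0206). -/
def PeriodicClassicalWitness : Prop :=
  ∃ (g : 𝕋² → E²) (h : 𝕋² → ℝ),
    Torus.IsSmooth g ∧ Torus.IsDivFree g ∧ Torus.HasZeroMean g ∧ Torus.IsSmooth h ∧ Torus.HasZeroMean h ∧
    ∃ (ν T : ℕ → ℝ) (v : ℕ → ℝ → 𝕋² → E²) (p : ℕ → ℝ → 𝕋² → ℝ) (θ : ℕ → ℝ → 𝕋² → ℝ) (Tmax E B ε : ℝ),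
      (∀ j, 0 < ν j) ∧ Tendsto ν atTop (𝓝 0) ∧ (∀ j, 0 < T j) ∧ (∀ j, T j ≤ Tmax) ∧
      (∀ j, Torus.IsClassicalNSSolutionOn (Ici 0) (ν j) (fun _ => g) (v j) (p j)) ∧
      (∀ j, Torus.IsClassicalScalarTransportForcedOn (Ici 0) (ν j) (v j) (fun _ => h) (θ j)) ∧
      (∀ j, Function.Periodic (v j) (T j)) ∧ (∀ j, Function.Periodic (θ j) (T j)) ∧
      (∀ j t, 0 ≤ t → ∫ x, ‖v j t x‖ ^ 2 ≤ E) ∧ (∀ j t, 0 ≤ t → Torus.scalarL2Sq (θ j t) ≤ B) ∧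
      0 < ε ∧ ∀ j, ε ≤ (T j)⁻¹ * ∫ t in (0 : ℝ)..T j, ν j * (Torus.eScalarGradNormSq (θ j t)).toReal

/-- **`S⁺_per → #2`** (bookkeeping over landed theorems): the period average of the `T_j`-periodic dissipation
IS its `limsup` long-time mean (`longTimeAvgSup_eq_of_periodic`, junk-free), so the periodic package is a
classical package in the sense of the landed junction `twohalfdThesis_of_classicalScalarAnomaly` (p90898), which
gives the route target `X`, and `X → #2` is `scalarAnomalySteadySourceFormal_of_twohalfdThesis` (p133429). [folklore] -/
theorem periodicClassicalWitness_imp : PeriodicClassicalWitness → ScalarAnomalySteadySourceFormal := by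
  rintro ⟨g, h, hgs, hgd, hgm, hhs, hhm, ν, T, v, p, θ, Tmax, E, B, ε, hν, hν0, hT, -, hNS, hSc, -, hθper,
    hE, hB, hε, hfl⟩
  refine scalarAnomalySteadySourceFormal_of_twohalfdThesis
    (twohalfdThesis_of_classicalScalarAnomaly
      ⟨g, h, hgs, hgd, hgm, hhs, hhm, ν, v, p, θ, E, B, ε, hν, hν0, hNS, hSc, hE, hB, hε, fun j => ?_⟩)
  have hper : Function.Periodic (fun t => ν j * (Torus.eScalarGradNormSq (θ j t)).toReal) (T j) := by
    intro t
    show ν j * (Torus.eScalarGradNormSq (θ j (t + T j))).toReal = ν j * (Torus.eScalarGradNormSq (θ j t)).toReal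
    rw [hθper j t]
  rw [longTimeAvgSup_eq_of_periodic hper (hT j)]
  exact hfl j

/-! ## Decomposition (D1): the necessary first piece — a log-strain bounded-energy planar family -/

/-- **`LogStrainFamily` (D1, the NECESSARY `∃`-piece of every witness).**  Some smooth solenoidal mean-zero
steady force `g`, `ν_j → 0`, and a family of global Leray–Hopf solutions of NS_{ν_j} forced by `g` (any `L²`
data) with `ν`-uniformly bounded `limsup`-mean energy whose `limsup`-mean strain is NOT sub-logarithmic:
`¬ (⟨√‖∇v_j‖²⟩ / log(1/ν_j) → 0)`.  It is, verbatim, an instance of the failure of the sibling conjecture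
`TwohalfdThesis.Negative.SubLogStrain` (= the registered residual S6 `stub_subLogStrain` of stmt-0211), and it is
IMPLIED by the crux (`logStrainFamily_of_crux`).  Strictly weaker than `#2` in content (strain need not be organised
into mixing: thin parallel shear layers carry log strain and mix algebraically, `Negative.ShearNoGo`), but already
where cascade phenomenology says the crux dies (`⟨‖∇v‖²⟩ ~ η^{2/3} log^{2/3}(1/ν)`, `η ≤ ‖Δg‖√E`). -/
def LogStrainFamily : Prop :=
  ∃ g : 𝕋² → E², Torus.IsSmooth g ∧ Torus.IsDivFree g ∧ Torus.HasZeroMean g ∧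
    ∃ (ν : ℕ → ℝ) (v₀ : ℕ → 𝕋² → E²) (v : ℕ → ℝ → 𝕋² → E²),
      (∀ j, 0 < ν j) ∧ Tendsto ν atTop (𝓝 0) ∧
      (∀ j, Torus.IsGlobalLerayHopf (ν j) (fun _ => g) (v₀ j) (v j)) ∧
      (∃ E : ℝ, ∀ j, meanEnergy (v j) ≤ E) ∧
      ¬ Tendsto (fun j => longTimeAvgSup (fun t => Real.sqrt (Torus.eGradNormSq (v j t)).toReal) /
          Real.log (ν j)⁻¹) atTop (𝓝 0)

/-! ## Negation: the counterexample to the crux is the planar sub-log strain law -/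

/-- **`SubLogStrain → ¬ #2`** — the crux is FALSE modulo the planar sub-log strain law (the `@[conjecture]` node
`TwohalfdThesis.Negative.SubLogStrain`, verbatim 0211's registered residual S6): composition of the landed
negative lemma `TwohalfdThesis_false_of_SubLogStrain : SubLogStrain → ¬X` with `#2 → X`
(`twohalfdThesis_of_scalarAnomalySteadySourceFormal`, p133429).  Read as a witness constraint: every witness of
the crux carries a `LogStrainFamily`. [folklore] -/
theorem not_crux_of_subLogStrain (hS6 : Negative.SubLogStrain) : ¬ ScalarAnomalySteadySourceFormal :=
  fun h2 => Negative.TwohalfdThesis_false_of_SubLogStrain hS6 (twohalfdThesis_of_scalarAnomalySteadySourceFormal h2)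

/-- **`#2 → LogStrainFamily`** (D1 is necessary): contrapositive of `not_crux_of_subLogStrain`, pushing the
negation through the universal quantifiers of `SubLogStrain`. [folklore] -/
theorem logStrainFamily_of_crux (h2 : ScalarAnomalySteadySourceFormal) : LogStrainFamily := by
  by_contra hcon
  refine not_crux_of_subLogStrain ?_ h2
  intro g hgs hgd hgz ν v₀ v hν hν0 hLH hE
  by_contra hT
  exact hcon ⟨g, hgs, hgd, hgz, ν, v₀, v, hν, hν0, hLH, hE, hT⟩

/-! ## Decomposition (D2): template-and-shadow split of the live kernel S1' (signatures only) -/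

/-- **Profile-mixer clause bundle over an ARBITRARY family of smooth solenoidal planar fields `U_j`** (no
Navier–Stokes): the (energy), (Decay) and (Floor) clauses of the live kernel S1' `stub_profileMixerRealizable`
(skeleton `Lines/budgeted_mixer_template.lean`), verbatim, with the classical NS family `v_j` replaced by `U_j`.
`KinematicTemplate` asks for SOME such family (a kinematic statement: sped-up and refined universal mixers of
Armstrong–Vicol / Elgindi–Liss–Mattingly type are the natural candidates, see the census); `ShadowedTemplate`
asks ONE steady force to realise a Navier–Stokes family uniformly `δ_j`-close to such a template. -/
def IsProfileMixerFamily (h : 𝕋² → ℝ) (ν : ℕ → ℝ) (U : ℕ → ℝ → 𝕋² → E²) (ρm : ℝ → ℝ)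
    (E R L c₀ : ℝ) : Prop :=
  (∀ j, 0 < ν j) ∧ Tendsto ν atTop (𝓝 0) ∧ 0 < L ∧ 0 < c₀ ∧
  Antitone ρm ∧ (∀ r, 0 ≤ ρm r) ∧ (∀ t, 0 ≤ t → ∫ r in (0 : ℝ)..t, ρm r ≤ R) ∧
  (∀ t, L ≤ t → Torus.scalarL2Sq h * ∫ r in L..t, ρm r ≤ c₀ / 2) ∧
  (∀ j, Torus.IsSmoothSpaceTimeOn (Ici 0) (U j)) ∧ (∀ j, ∀ t ∈ Ici (0 : ℝ), Torus.IsDivFree (U j t)) ∧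
  (∀ j t, 0 ≤ t → ∫ x, ‖U j t x‖ ^ 2 ≤ E) ∧
  (∀ j (s T' : ℝ), 0 ≤ s → ∀ φ : ℝ → 𝕋² → ℝ,
      Torus.IsClassicalScalarTransportOn (Icc s T') (ν j) (U j) φ → φ s = h →
      ∀ t ∈ Icc s T', Torus.scalarL2Sq (φ t) ≤ ρm (t - s) ^ 2 * Torus.scalarL2Sq h) ∧
  (∀ j (s : ℝ), 0 ≤ s → ∀ θ' : ℝ → 𝕋² → ℝ,
      Torus.IsClassicalScalarTransportForcedOn (Icc s (s + L)) (ν j) (U j) (fun _ => h) θ' →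
      θ' s = (fun _ => (0 : ℝ)) → c₀ ≤ ∫ x, h x * θ' (s + L) x)

/-- **`KinematicTemplate` (D2, `∃`, no Navier–Stokes):** some smooth mean-zero profile `h` and SOME family of smooth
solenoidal planar fields of pointwise bounded energy whose `κ = ν_j` releases of `h` obey a `j`- and
start-time-uniform integrable antitone majorant, with the cold-start floor. -/
def KinematicTemplate : Prop :=
  ∃ (h : 𝕋² → ℝ) (ν : ℕ → ℝ) (U : ℕ → ℝ → 𝕋² → E²) (ρm : ℝ → ℝ) (E R L c₀ : ℝ),
    Torus.IsSmooth h ∧ Torus.HasZeroMean h ∧ IsProfileMixerFamily h ν U ρm E R L c₀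

/-- **`ShadowedTemplate c` (D2, `∃`, the dynamical piece):** a template as above TOGETHER WITH one smooth solenoidal
mean-zero steady force `g` and classical solutions `(v_j, p_j)` of NS_{ν_j} forced by `g` on `[0, ∞)` that stay
uniformly `c·ν_j^{1/2}`-close to the template fields for all times: `‖v_j(t,x) - U_j(t,x)‖ ≤ c √ν_j`.  (Backward
Gronwall through the template's own Lipschitz constant `L_j → ∞` shows this forces `U_j` to be an NS_{ν_j}(g) family
up to a forcing defect `≲ √ν_j e^{-L_j t}` — the piece CONTAINS the crux's realisability question with the architecture
fixed in advance; see the census.) -/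
def ShadowedTemplate (c : ℝ) : Prop :=
  ∃ (h : 𝕋² → ℝ) (ν : ℕ → ℝ) (U : ℕ → ℝ → 𝕋² → E²) (ρm : ℝ → ℝ) (E R L c₀ : ℝ),
    Torus.IsSmooth h ∧ Torus.HasZeroMean h ∧ IsProfileMixerFamily h ν U ρm E R L c₀ ∧
    ∃ (g : 𝕋² → E²) (v : ℕ → ℝ → 𝕋² → E²) (p : ℕ → ℝ → 𝕋² → ℝ),
      Torus.IsSmooth g ∧ Torus.IsDivFree g ∧ Torus.HasZeroMean g ∧
      (∀ j, Torus.IsClassicalNSSolutionOn (Ici 0) (ν j) (fun _ => g) (v j) (p j)) ∧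
      ∀ j t x, 0 ≤ t → ‖v j t x - U j t x‖ ≤ c * Real.sqrt (ν j)

/-- **`ShadowGlue` (D2, `∀`, linear PDE — the provable piece, M/L):** for every profile-mixer template there is a
tolerance `c > 0` such that ANY family of smooth solenoidal drifts `v_j` uniformly `c√ν_j`-close to the template is
again a profile mixer for the same `h` (with worse constants).  Route: the difference `w` of the two classical releases
(or cold starts) of the same datum solves `∂ₜw + v_j·∇w - ν_jΔw = -(v_j - U_j)·∇φ^U`, so
`‖w(t)‖ ≤ c√ν_j ∫ₛᵗ‖∇φ^U‖ ≤ c√ν_j √(t-s) (∫ₛᵗ‖∇φ^U‖²)^{1/2} ≤ c ‖h‖ √((t-s)/2)` by the energy identity of `φ^U`;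
choose the lag where `ρm ≤ 1/2` and `c` accordingly, then iterate the contraction (semigroup property of releases,
`L²`-contractivity) to rebuild an integrable antitone majorant; the floor moves by `O(c)`. -/
def ShadowGlue : Prop :=
  ∀ (h : 𝕋² → ℝ) (ν : ℕ → ℝ) (U : ℕ → ℝ → 𝕋² → E²) (ρm : ℝ → ℝ) (E R L c₀ : ℝ),
    Torus.IsSmooth h → Torus.HasZeroMean h → IsProfileMixerFamily h ν U ρm E R L c₀ →
    ∃ c : ℝ, 0 < c ∧
      ∀ (v : ℕ → ℝ → 𝕋² → E²), (∀ j, Torus.IsSmoothSpaceTimeOn (Ici 0) (v j)) →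
        (∀ j, ∀ t ∈ Ici (0 : ℝ), Torus.IsDivFree (v j t)) →
        (∀ j t x, 0 ≤ t → ‖v j t x - U j t x‖ ≤ c * Real.sqrt (ν j)) →
        ∃ (ρm' : ℝ → ℝ) (E' R' L' c₀' : ℝ), IsProfileMixerFamily h ν v ρm' E' R' L' c₀'

end Summit.AnomalousDissipation.AnomalousDissipation.Cruxes.ScalarAnomalySteadySourceFormal.StrategistCensus

end
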